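import Mathlib
import Summits.Ventures.PercRepro2.Defs
import Summits.Ventures.PercRepro2.Independence
import Summits.Ventures.PercRepro2.Harris
import Summits.Ventures.PercRepro2.CoinDefs
import Summits.Ventures.PercRepro2.CoinArcsOff
import Summits.Ventures.PercRepro2.CoinInduced
import Summits.Ventures.PercRepro2.CoinVdBK
import Summits.Ventures.PercRepro2.CoinReverse
import Summits.Ventures.PercRepro2.CoinPendant
import Summits.Ventures.PercRepro2.CoinDarcMixed
import Summits.Ventures.PercRepro2.CoinTraceLevels
import Summits.Ventures.PercRepro2.CoinKStarLaw
import Summits.Ventures.PercRepro2.CoinKStarTrace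

/-!
# Star cores: reachability, star cylinders and the star mass decomposition (blind cell PercRepro2,
night-2 g7; proofs/NIGHT2-DARC.md §30)

A STAR CORE: the root `s` has the independent single-arc coins `c v = {s → v}` (`v ∈ C`) as its
only out-arcs, these are the only arcs into `C`, and nothing enters `s`.  The rest of the system
(the «head»: entries from `C` and whatever lies beyond, `t` included) is ARBITRARY mixed.  On the
star cylinder `{ω (c v) = 1 ↔ v ∈ L}` the forward cluster of `s` meets `C` exactly in `L`, the
markers `1[a ∈ S⁺]`, `1[b ∈ S⁺]` (`a, b ∈ C`) are the constants `1[a ∈ L]`, `1[b ∈ L]`, the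
avoidance event `R_t` is «no vertex of `L` reaches `t` without the star arcs»
(`starAvoidEvent`), and the gate event of `u → w` (`u ∈ C`, `w ∉ C ∪ {s}`) adds `w` to the avoided
set when `u ∈ L`.  The star cylinders are independent of the head (`starMass`), so every mass of
row 2′DARC is a sum over `L ⊆ C` of `leafLaw(L) · A(L′) · (marker data)` with
`A(X) = P(X ↛ t in D − (arcs out of s))` — and `A` is LOG-SUPERMODULAR by the reversed van den
Berg–Kahn inequality (`vdBKC_rev`).  This file holds the reachability lemmas of a star core
(`StarCore`), the star cylinders, the two partitions (`avoid_eq_biUnion`, `gate_eq_biUnion`) and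
the mass decomposition `star_mass`; `CoinStarCore.lean` assembles them into the theorem
`darc_of_starCore`.
-/

namespace Summit.Ventures.PercRepro2.Coin

open Classical

section StarReach

variable {V : Type*} {E : Type*} [DecidableEq V]

/-- A star core: the coins `c v = {s → v}` (`v ∈ C`), injective; they are the only arcs out of `s`
and the only arcs into `C`; no arc enters `s`; `s ∉ C`. -/
structure StarCore (arcs : E → Finset (V × V)) (s : V) (C : Finset V) (c : V → E) : Prop where
  star : ∀ v ∈ C, arcs (c v) = {(s, v)}
  inj : Set.InjOn c C
  out_s : ∀ e, ∀ xy ∈ arcs e, xy.1 = s → ∃ v ∈ C, e = c v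
  into_s : ∀ e, ∀ xy ∈ arcs e, xy.2 ≠ s
  into_C : ∀ e, ∀ xy ∈ arcs e, xy.2 ∈ C → xy.1 = s
  s_notin : s ∉ C

variable {arcs : E → Finset (V × V)} {s : V} {C : Finset V} {c : V → E}

omit [DecidableEq V] in
/-- The open arcs out of `s` are the open star arcs. -/
lemma StarCore.openArc_s_iff (h : StarCore arcs s C c) {ω : Config E} {y : V} :
    OpenArc arcs ω s y ↔ ∃ v ∈ C, y = v ∧ ω (c v) = true := by
  constructor
  · rintro ⟨e, he, hxy⟩
    obtain ⟨v, hv, rfl⟩ := h.out_s e _ hxy rfl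
    rw [h.star v hv, Finset.mem_singleton, Prod.mk.injEq] at hxy
    exact ⟨v, hv, hxy.2, he⟩
  · rintro ⟨v, hv, hyv, hω⟩
    exact ⟨c v, hω, by rw [hyv, h.star v hv]; exact Finset.mem_singleton_self _⟩

omit [DecidableEq V] in
/-- Only `s` reaches `s`. -/
lemma StarCore.eq_s_of_reach (h : StarCore arcs s C c) {ω : Config E} {x : V}
    (hx : Reach arcs ω x s) : x = s := by
  induction hx with
  | refl => rfl
  | @tail y z _ hstep _ =>
    obtain ⟨e, _, hxy⟩ := hstep
    exact absurd rfl (h.into_s e _ hxy)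

/-- Away from `s`, reachability is that of the reduced map `D − (arcs out of s)`. -/
lemma StarCore.reach_iff_arcsOff (h : StarCore arcs s C c) {ω : Config E} {x y : V} (hx : x ≠ s) :
    Reach arcs ω x y ↔ Reach (arcsOff arcs {s}) ω x y := by
  constructor
  · intro hr
    rcases reach_split {s} hr with h₀ | ⟨z, hz, hxz, _⟩
    · exact h₀
    · rw [Finset.mem_singleton] at hz
      subst hz
      exact absurd (h.eq_s_of_reach (reach_of_reach_arcsOff hxz)) hx
  · exact reach_of_reach_arcsOff

/-- Reachability from `s`: the root itself, or an open star arc followed by a path of the reduced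
map. -/
lemma StarCore.reach_s_iff (h : StarCore arcs s C c) {ω : Config E} {y : V} :
    Reach arcs ω s y ↔ y = s ∨ ∃ v ∈ C, ω (c v) = true ∧ Reach (arcsOff arcs {s}) ω v y := by
  constructor
  · intro hr
    rcases Relation.ReflTransGen.cases_head hr with rfl | ⟨y', hsy', hy'y⟩
    · exact Or.inl rfl
    · obtain ⟨v, hv, hyv, hω⟩ := h.openArc_s_iff.mp hsy'
      subst hyv
      have hvs : y' ≠ s := fun hvs => h.s_notin (hvs ▸ hv)
      exact Or.inr ⟨y', hv, hω, (h.reach_iff_arcsOff hvs).mp hy'y⟩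
  · rintro (rfl | ⟨v, hv, hω, hr⟩)
    · exact reach_refl arcs ω y
    · exact reach_trans (reach_of_openArc (h.openArc_s_iff.mpr ⟨v, hv, rfl, hω⟩))
        (reach_of_reach_arcsOff hr)

/-- No arc of the reduced map enters `C`. -/
lemma StarCore.not_into_C (h : StarCore arcs s C c) {e : E} {xy : V × V}
    (hxy : xy ∈ arcsOff arcs {s} e) : xy.2 ∉ C := by
  simp only [arcsOff, Finset.mem_filter, Finset.mem_singleton] at hxy
  intro hC
  exact hxy.2 (h.into_C e xy hxy.1 hC)

/-- In the reduced map a vertex of `C` is reached by itself only. -/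
lemma StarCore.eq_of_reach_arcsOff (h : StarCore arcs s C c) {ω : Config E} {x v : V}
    (hv : v ∈ C) (hr : Reach (arcsOff arcs {s}) ω x v) : x = v := by
  induction hr with
  | refl => rfl
  | @tail y z _ hstep _ =>
    obtain ⟨e, _, hxy⟩ := hstep
    exact absurd hv (h.not_into_C hxy)

/-- `v ∈ S⁺` iff its star coin is open (`v ∈ C`). -/
lemma StarCore.fwd_iff (h : StarCore arcs s C c) {ω : Config E} {v : V} (hv : v ∈ C) :
    Reach arcs ω s v ↔ ω (c v) = true := by
  rw [h.reach_s_iff]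
  constructor
  · rintro (rfl | ⟨v', hv', hω, hr⟩)
    · exact absurd hv h.s_notin
    · rw [h.eq_of_reach_arcsOff hv hr] at hω; exact hω
  · intro hω
    exact Or.inr ⟨v, hv, hω, reach_refl _ ω v⟩

/-- `R_t` on a star core: every open star arc leads to a vertex that does not reach `t` in the
reduced map. -/
lemma StarCore.avoid_iff (h : StarCore arcs s C c) {t : V} (ht : t ≠ s) {ω : Config E} :
    ω ∈ avoidEvent arcs s {t} ↔
      ∀ v ∈ C, ω (c v) = true → ¬ Reach (arcsOff arcs {s}) ω v t := by
  simp only [avoidEvent, Set.mem_setOf_eq, Finset.mem_singleton, forall_eq]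
  rw [h.reach_s_iff]
  constructor
  · intro hh v hv hω hr; exact hh (Or.inr ⟨v, hv, hω, hr⟩)
  · intro hh
    rintro (hts | ⟨v, hv, hω, hr⟩)
    · exact ht hts
    · exact hh v hv hω hr

/-- The gate event of `u → w` on a star core (`u ∈ C`, `w ≠ s`): `R_t`, and if the star coin of
`u` is open then `w` does not reach `t` in the reduced map. -/
lemma StarCore.gate_iff (h : StarCore arcs s C c) {t u w : V} (hu : u ∈ C)
    (hw : w ≠ s) {ω : Config E} :
    ω ∈ gateEvent arcs s {t} u w ↔
      ω ∈ avoidEvent arcs s {t} ∧ (ω (c u) = true → ¬ Reach (arcsOff arcs {s}) ω w t) := by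
  rw [gateEvent_eq_union]
  simp only [Set.mem_inter_iff, Set.mem_union, Set.mem_compl_iff, fwdEvent, bwdEvent,
    Set.mem_setOf_eq, Finset.mem_singleton, exists_eq_left]
  rw [h.fwd_iff hu, h.reach_iff_arcsOff hw]
  constructor
  · rintro ⟨hR, hg⟩
    refine ⟨hR, fun hω hr => ?_⟩
    rcases hg with hg | hg
    · exact hg hω
    · exact hg hr
  · rintro ⟨hR, hg⟩
    refine ⟨hR, ?_⟩
    by_cases hω : ω (c u) = true
    · exact Or.inr (hg hω)
    · exact Or.inl hω

end StarReach

section StarCylinders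

variable {V : Type*} {E : Type*} [Fintype V] [DecidableEq V] [Fintype E] [DecidableEq E]
  {R : Type*} [Field R] [LinearOrder R] [IsStrictOrderedRing R]

/-- The star cylinder of `L ⊆ C`: the star coin of `v` is open iff `v ∈ L`. -/
def starCyl (C : Finset V) (c : V → E) (L : Finset V) : Set (Config E) :=
  cylinder (C.image c) (starState c L)

/-- The head's avoidance event: no vertex of `X` reaches `t` without the arcs out of `s`. -/
def starAvoidEvent (arcs : E → Finset (V × V)) (s t : V) (X : Finset V) : Set (Config E) :=
  {ω | ∀ v ∈ X, ¬ Reach (arcsOff arcs {s}) ω v t}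

/-- The avoided set of the gate piece on the cylinder `L`: `L`, with `w` added when `u ∈ L`. -/
def starTarget (u w : V) (L : Finset V) : Finset V := if u ∈ L then insert w L else L

variable {arcs : E → Finset (V × V)} {s : V} {C : Finset V} {c : V → E}

omit [Fintype V] [Fintype E] in
/-- Membership in a star cylinder. -/
lemma StarCore.mem_starCyl (h : StarCore arcs s C c) {L : Finset V} (hL : L ⊆ C) {ω : Config E} :
    ω ∈ starCyl C c L ↔ ∀ v ∈ C, (ω (c v) = true ↔ v ∈ L) := by
  simp only [starCyl, mem_cylinder, Finset.mem_image, forall_exists_index, and_imp,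
    forall_apply_eq_imp_iff₂]
  constructor
  · intro hh v hv
    rw [hh v hv, starState_leaf h.inj hL hv, decide_eq_true_eq]
  · intro hh v hv
    rw [starState_leaf h.inj hL hv]
    by_cases hvL : v ∈ L
    · simp [hvL, (hh v hv).mpr hvL]
    · have : ω (c v) ≠ true := fun h' => hvL ((hh v hv).mp h')
      simp [hvL, this]

omit [Fintype V] [LinearOrder R] [IsStrictOrderedRing R] in
/-- The probability of a star cylinder is the product law. -/
lemma StarCore.prob_starCyl (h : StarCore arcs s C c) (p : E → R) {L : Finset V} (hL : L ⊆ C) :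
    prob p (starCyl C c L) = leafLaw C (fun v => p (c v)) L :=
  prob_cylinder_leaf p h.inj hL

omit [Fintype V] [Fintype E] in
/-- Distinct star cylinders are disjoint. -/
lemma StarCore.disjoint_starCyl (h : StarCore arcs s C c) {L L' : Finset V} (hL : L ⊆ C)
    (hL' : L' ⊆ C) (hne : L ≠ L') : Disjoint (starCyl C c L) (starCyl C c L') := by
  rw [Set.disjoint_left]
  intro ω hω hω'
  apply hne
  ext v
  constructor
  · intro hv
    exact ((h.mem_starCyl hL').mp hω' v (hL hv)).mp (((h.mem_starCyl hL).mp hω v (hL hv)).mpr hv)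
  · intro hv
    exact ((h.mem_starCyl hL).mp hω v (hL' hv)).mp (((h.mem_starCyl hL').mp hω' v (hL' hv)).mpr hv)

omit [Fintype V] [Fintype E] in
/-- The star cylinders over `C.powerset` are pairwise disjoint (whatever the second factors). -/
lemma StarCore.pairwiseDisjoint_starCyl (h : StarCore arcs s C c)
    (A : Finset V → Set (Config E)) :
    (↑C.powerset : Set (Finset V)).PairwiseDisjoint (fun L => starCyl C c L ∩ A L) := by
  intro L hL L' hL' hne
  exact Set.disjoint_of_subset Set.inter_subset_left Set.inter_subset_left
    (h.disjoint_starCyl (Finset.mem_powerset.mp hL) (Finset.mem_powerset.mp hL') hne)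

omit [Fintype V] [DecidableEq V] [Fintype E] in
/-- A star cylinder depends on the star coins only. -/
lemma dependsOn_starCyl (C : Finset V) (c : V → E) (L : Finset V) :
    DependsOn (· ∈ starCyl C c L) (↑(C.image c) : Set E) := by
  intro ω ω' hh
  simp only [starCyl, mem_cylinder, eq_iff_iff]
  constructor
  · intro h e he; rw [← hh e he]; exact h e he
  · intro h e he; rw [hh e he]; exact h e he

omit [Fintype V] [Fintype E] [DecidableEq E] in
/-- The star coins carry no arc of the reduced map. -/
lemma StarCore.arcsOff_star (h : StarCore arcs s C c) {v : V} (hv : v ∈ C) :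
    arcsOff arcs {s} (c v) = ∅ := by
  simp only [arcsOff]
  rw [h.star v hv, Finset.filter_singleton]
  simp

omit [Fintype V] [Fintype E] in
/-- The head's avoidance event depends on the non-star coins only. -/
lemma StarCore.dependsOn_starAvoid (h : StarCore arcs s C c) (t : V) (X : Finset V) :
    DependsOn (· ∈ starAvoidEvent arcs s t X) (↑(C.image c) : Set E)ᶜ := by
  intro ω ω' hh
  have hcongr : ∀ e, arcsOff arcs {s} e ≠ ∅ → ω e = ω' e := by
    intro e he
    by_cases hmem : e ∈ (↑(C.image c) : Set E)
    · obtain ⟨v, hv, rfl⟩ := Finset.mem_image.mp (Finset.mem_coe.mp hmem)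
      exact absurd (h.arcsOff_star hv) he
    · exact hh e hmem
  simp only [starAvoidEvent, Set.mem_setOf_eq, eq_iff_iff]
  constructor
  · intro h' v hv hr; exact h' v hv ((reach_arcsOff_congr hcongr).mpr hr)
  · intro h' v hv hr; exact h' v hv ((reach_arcsOff_congr hcongr).mp hr)

omit [Fintype V] [Fintype E] [LinearOrder R] [IsStrictOrderedRing R] in
/-- On the star cylinder of `L` the marker of `a ∈ C` is the constant `1[a ∈ L]`. -/
lemma StarCore.marker_on_starCyl (h : StarCore arcs s C c) {L : Finset V}
    (hL : L ⊆ C) {a : V} (ha : a ∈ C) {ω : Config E} (hω : ω ∈ starCyl C c L) :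
    marker (R := R) arcs s a ω = if a ∈ L then 1 else 0 := by
  simp only [marker]
  rw [h.fwd_iff ha, (h.mem_starCyl hL).mp hω a ha]
  by_cases haL : a ∈ L <;> simp [haL]

omit [Fintype V] [Fintype E] in
/-- `R_t` is the disjoint union over `L ⊆ C` of «star cylinder `L` and `L` avoids `t`». -/
theorem StarCore.avoid_eq_biUnion (h : StarCore arcs s C c) {t : V} (ht : t ≠ s) :
    avoidEvent arcs s {t} = ⋃ L ∈ C.powerset, starCyl C c L ∩ starAvoidEvent arcs s t L := by
  ext ω
  simp only [Set.mem_iUnion, Set.mem_inter_iff, exists_prop, Finset.mem_powerset]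
  constructor
  · intro hω
    refine ⟨C.filter (fun v => ω (c v) = true), Finset.filter_subset _ _, ?_, ?_⟩
    · rw [h.mem_starCyl (Finset.filter_subset _ _)]
      intro v hv
      simp [Finset.mem_filter, hv]
    · intro v hv
      rw [Finset.mem_filter] at hv
      exact (h.avoid_iff ht).mp hω v hv.1 hv.2
  · rintro ⟨L, hL, hcyl, hav⟩
    rw [h.avoid_iff ht]
    intro v hv hωv
    exact hav v (((h.mem_starCyl hL).mp hcyl v hv).mp hωv)

omit [Fintype V] [Fintype E] in
/-- The gate event of `u → w` is the disjoint union over `L ⊆ C` of «star cylinder `L` and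
`starTarget u w L` avoids `t`». -/
theorem StarCore.gate_eq_biUnion (h : StarCore arcs s C c) {t u w : V} (ht : t ≠ s) (hu : u ∈ C)
    (hw : w ≠ s) :
    gateEvent arcs s {t} u w =
      ⋃ L ∈ C.powerset, starCyl C c L ∩ starAvoidEvent arcs s t (starTarget u w L) := by
  ext ω
  simp only [Set.mem_iUnion, Set.mem_inter_iff, exists_prop, Finset.mem_powerset]
  rw [h.gate_iff hu hw]
  constructor
  · rintro ⟨hR, hg⟩
    refine ⟨C.filter (fun v => ω (c v) = true), Finset.filter_subset _ _, ?_, ?_⟩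
    · rw [h.mem_starCyl (Finset.filter_subset _ _)]
      intro v hv
      simp [Finset.mem_filter, hv]
    · intro v hv
      simp only [starTarget] at hv
      split_ifs at hv with huL
      · rw [Finset.mem_insert] at hv
        rcases hv with rfl | hv
        · exact hg (Finset.mem_filter.mp huL).2
        · rw [Finset.mem_filter] at hv
          exact (h.avoid_iff ht).mp hR v hv.1 hv.2
      · rw [Finset.mem_filter] at hv
        exact (h.avoid_iff ht).mp hR v hv.1 hv.2
  · rintro ⟨L, hL, hcyl, hav⟩
    have hsub : L ⊆ starTarget u w L := by
      simp only [starTarget]; split_ifs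
      · exact Finset.subset_insert _ _
      · exact le_rfl
    refine ⟨?_, ?_⟩
    · rw [h.avoid_iff ht]
      intro v hv hωv
      exact hav v (hsub (((h.mem_starCyl hL).mp hcyl v hv).mp hωv))
    · intro hωu
      have huL : u ∈ L := ((h.mem_starCyl hL).mp hcyl u hu).mp hωu
      apply hav w
      simp [starTarget, huL]

omit [Fintype V] [DecidableEq V] [LinearOrder R] [IsStrictOrderedRing R] in
/-- The mass of a constant on an event. -/
lemma star_massE_const (p : E → R) (k : R) (S : Set (Config E)) :
    massE p (fun _ => k) S = k * prob p S := by
  unfold massE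
  rw [prob_eq_expect_indicator, ← expect_const_mul]
  congr 1
  ext ω
  by_cases hω : ω ∈ S <;> simp [hω]

omit [Fintype V] [LinearOrder R] [IsStrictOrderedRing R] in
/-- **The star mass decomposition**: for an observable that is the constant `g L` on the star
cylinder of `L`, the mass over `⊔_L (cylinder L ∩ head-avoidance of X L)` is
`Σ_L g L · leafLaw L · A (X L)` with `A X = P(X ↛ t without the arcs out of s)`. -/
theorem StarCore.star_mass (h : StarCore arcs s C c) (p : E → R) (t : V)
    (X : Finset V → Finset V) {f : Config E → R} {g : Finset V → R}
    (hfg : ∀ L ⊆ C, ∀ ω ∈ starCyl C c L, f ω = g L) :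
    massE p f (⋃ L ∈ C.powerset, starCyl C c L ∩ starAvoidEvent arcs s t (X L)) =
      ∑ L ∈ C.powerset, g L * (leafLaw C (fun v => p (c v)) L *
        prob p (starAvoidEvent arcs s t (X L))) := by
  rw [massE_biUnion p f _ _ (h.pairwiseDisjoint_starCyl _)]
  refine Finset.sum_congr rfl fun L hL => ?_
  have hL' : L ⊆ C := Finset.mem_powerset.mp hL
  rw [massE_congr' p (g := fun _ => g L) (fun ω hω => hfg L hL' ω hω.1), star_massE_const,
    prob_inter_eq_mul_of_dependsOn p disjoint_compl_right (dependsOn_starCyl C c L)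
      (h.dependsOn_starAvoid t (X L)), h.prob_starCyl p hL']

end StarCylinders

end Summit.Ventures.PercRepro2.Coin
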